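import Literature.NumberTheory.Connes2026.SemilocalCutoffScaleInvariance
import Literature.NumberTheory.ConnesConsani2021.CutoffProjHatSincKernel
import Literature.Analysis.OperatorTheory.LpDilation
import HarnessLib

/-!
# The ultraviolet cutoff `P̂⁰_M = 𝓕 P_M 𝓕⁻¹` of `L²(ℝ)` is convolution with the dilated sinc kernel
# `M κ(M(x − y))`, `κ(v) = sin(2πv)/(πv)`

LABEL (line 1): RH-FREE literature (theorems only; NO definition, NO named fact).  bears_on: LADDER-RH
W-C/W-P (C1 named-fact debt), cell `rh-crit`, sub-cell cc, overflow row O1 — first input of the SEPARATED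
remainder estimate (S1,S0,S2) of the "annulus road" under `Connes1999_thm_VII_4_rat` (the kernel of
`(1 − Q̃) P̂⁰_M Q₀`).  WHAT THIS IS NOT: any claim about positivity, Weil's criterion or RH.

Sources.  A. Connes, C. Consani (2021) [`ConnesConsani2021`], §4 p. 15 eq. (complementproj) (the dual cutoff
as the sinc convolution; tree `cutoffProjHat_one_coeFn` for `M = 1`); A. Connes, Selecta Math. 5 (1999)
[`Connes1999`], §VII eq. (13) (`R_Λ = P̂_Λ P_Λ`).

## What is proved

* `dualCutoffProj_empty_eq_cutoffProjHat` — `dualCutoffProj ∅ Λ = cutoffProjHat Λ` (both are `𝓕 P_Λ 𝓕⁻¹`);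
* `dualCutoffProj_empty_one_coeFn` — `(P̂⁰_1 φ)(x) = ∫ κ(x − y) φ(y) dy` a.e.;
* **`dualCutoffProj_empty_coeFn`** — for `M > 0`: `(P̂⁰_M φ)(x) = ∫ M κ(M(x − y)) φ(y) dy` a.e.
  (scale covariance `P̂⁰_M = ϑ_{−log M} P̂⁰_1 ϑ_{log M}` and the substitution `y = M y'`).

No instance, notation or attribute; no `def`.
-/

noncomputable section

open _root_.MeasureTheory Complex Set Filter
open scoped Real Topology ComplexConjugate InnerProductSpace FourierTransform

namespace Literature.NumberTheory.Connes2026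

open Literature.NumberTheory.LFunctions Literature.Analysis.OperatorTheory
open Literature.NumberTheory.ConnesConsani
open Literature.NumberTheory.ConnesConsani2024
open Literature.NumberTheory.ConnesConsani2021 hiding cutoffProj cutoffProj_coeFn

/-- `dualCutoffProj ∅ Λ` is Connes–Consani's `cutoffProjHat Λ = 𝓕⁻¹ P_Λ 𝓕 = 𝓕 P_Λ 𝓕⁻¹`. [cite: ConnesConsani2021, §4 p. 15 eq. (complementproj); Connes1999, §VII eq. (13)] -/
theorem dualCutoffProj_empty_eq_cutoffProjHat (Λ : ℝ) : dualCutoffProj ∅ Λ = cutoffProjHat Λ := by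
  refine ContinuousLinearMap.ext fun φ => ?_
  rw [dualCutoffProj_empty]
  exact fourier_cutoffProj_fourierInv Λ φ

/-- **`(P̂⁰_1 φ)(x) = ∫ κ(x − y) φ(y) dy` a.e.** [cite: ConnesConsani2021, §4 p. 15 eq. (complementproj)] -/
theorem dualCutoffProj_empty_one_coeFn (φ : Lp ℂ 2 (volume : Measure ℝ)) :
    (dualCutoffProj ∅ 1 φ : ℝ → ℂ) =ᵐ[volume] fun x => ∫ y, sincKernel (x - y) * φ y := by
  rw [dualCutoffProj_empty_eq_cutoffProjHat]
  exact cutoffProjHat_one_coeFn φ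

/-- **`(P̂⁰_M φ)(x) = ∫ M κ(M(x − y)) φ(y) dy` a.e., for `M > 0`.** [cite: ConnesConsani2021, §4 p. 15 eq. (complementproj); Connes1999, §VII eq. (13)] -/
theorem dualCutoffProj_empty_coeFn {M : ℝ} (hM : 0 < M) (φ : Lp ℂ 2 (volume : Measure ℝ)) :
    (dualCutoffProj ∅ M φ : ℝ → ℂ) =ᵐ[volume] fun x => ∫ y, (M : ℂ) * sincKernel (M * (x - y)) * φ y := by
  -- scale covariance: `P̂⁰_M = ϑ_{−log M} P̂⁰_1 ϑ_{log M}`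
  have hconj : dualCutoffProj ∅ M =
      scalingUnitary (-Real.log M) * dualCutoffProj ∅ 1 * scalingUnitary (Real.log M) := by
    have h := dualCutoffProj_empty_eq_conj M (-Real.log M)
    rwa [Real.exp_neg, Real.exp_log hM, mul_inv_cancel₀ hM.ne', neg_neg] at h
  rw [hconj]
  change ((scalingUnitary (-Real.log M)) ((dualCutoffProj ∅ 1) ((scalingUnitary (Real.log M)) φ)) : ℝ → ℂ)
    =ᵐ[volume] _
  set ψ := scalingUnitary (Real.log M) φ with hψ
  have e1 := scalingUnitary_coeFn (-Real.log M) (dualCutoffProj ∅ 1 ψ)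
  have e2 := (quasiMeasurePreserving_smul' (V := ℝ) hM.ne').ae_eq_comp (dualCutoffProj_empty_one_coeFn ψ)
  have e3 := scalingUnitary_coeFn (Real.log M) φ
  have hexp1 : Real.exp (-(-Real.log M)) = M := by rw [neg_neg, Real.exp_log hM]
  have hexpm : Real.exp (-Real.log M) = M⁻¹ := by rw [Real.exp_neg, Real.exp_log hM]
  have hee : (Real.exp (-(-Real.log M) / 2) : ℂ) * (Real.exp (-Real.log M / 2) : ℂ) = 1 := by
    rw [← Complex.ofReal_mul, ← Real.exp_add, show -(-Real.log M) / 2 + -Real.log M / 2 = 0 by ring,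
      Real.exp_zero, Complex.ofReal_one]
  filter_upwards [e1, e2] with x h1 h2
  rw [h1, hexp1]
  have h2' : (dualCutoffProj ∅ 1 ψ : ℝ → ℂ) (M * x) = ∫ y, sincKernel (M * x - y) * ψ y := by
    simpa only [smul_eq_mul, Function.comp] using h2
  rw [h2']
  have h3 : ∫ y, sincKernel (M * x - y) * ψ y =
      ∫ y, sincKernel (M * x - y) * ((Real.exp (-Real.log M / 2) : ℂ) * φ (M⁻¹ * y)) := by
    refine integral_congr_ae ?_
    filter_upwards [e3] with y hy
    rw [hy, hexpm]
  rw [h3]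
  have h4 : (fun y => sincKernel (M * x - y) * ((Real.exp (-Real.log M / 2) : ℂ) * φ (M⁻¹ * y))) =
      fun y => (fun y' => (Real.exp (-Real.log M / 2) : ℂ) * (sincKernel (M * (x - y')) * φ y')) (M⁻¹ * y) := by
    funext y
    simp only [mul_sub, mul_inv_cancel_left₀ hM.ne']
    ring
  rw [h4, Measure.integral_comp_mul_left (fun y' => (Real.exp (-Real.log M / 2) : ℂ) * (sincKernel (M * (x - y')) * φ y'))
    M⁻¹, inv_inv, abs_of_pos hM, integral_const_mul, Complex.real_smul]
  have h5 : ∫ y, (M : ℂ) * sincKernel (M * (x - y)) * φ y = (M : ℂ) * ∫ y, sincKernel (M * (x - y)) * φ y := by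
    rw [← integral_const_mul]
    refine integral_congr_ae (ae_of_all _ fun y => ?_)
    simp only [mul_assoc]
  rw [h5]
  linear_combination ((M : ℂ) * ∫ y, sincKernel (M * (x - y)) * φ y) * hee

end Literature.NumberTheory.Connes2026
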